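import Summits.ResolutionOfSingularities.ResolutionOfSingularities.Theorems.HomologicalConductorNoZenoRBlowupStage
import Summits.ResolutionOfSingularities.ResolutionOfSingularities.Theorems.HomologicalConductorNoZenoRFirstKindAssembly
import Literature.AlgebraicGeometry.Resolution.EmbeddedCurvePointBlowups
import HarnessLib

/-!
# Crux `NoZenoR` (stmt-ResolutionOfSingularities-19943) — ZARISKI'S FACTORISATION THEOREM (Stacks 0C5R) for
# desingularizations of a normal surface singularity: every `S`-morphism between two desingularizations is, up to an
# isomorphism of the source, a composition of blowings up of closed points

Route `ResolutionOfSingularities/HomologicalConductor` (cell decomp-res, hand leafhand-res-homologicalconduct-18 g1).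
OURS: AI-written proof over tree theorems, weaker than expert review; nothing here is a statement of the manuscript
under review (Hironaka 2017).  SUPPORT level, counted 0.  Def-free, no new named facts.

Let `S` be a two-dimensional Noetherian local normal domain, `ρ : Y → Spec S` and `π : X → Spec S` desingularizations
and `h : X → Y` an `S`-morphism (`h ≫ ρ = π`).

* `exists_isPointBlowupComposition_of_fac` — **Zariski factorisation**: `h = e ≫ π'` with `e` an isomorphism and
  `π'` a composition of blowings up at closed points over the closed point of `S` (tree inductive
  `IsPointBlowupComposition`), by induction on `#excCurvePoints π − #excCurvePoints ρ`: the one-step descent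
  `FirstKind.step` (hand 18 g1: purity + Zariski's Main Theorem + FactorStep′ + regularity of the blown-up stage) and
  the count of hand 16 g3 (`ncard_excCurvePoints_blowup_point`: each step adds an exceptional curve downstairs,
  `ncard_excCurvePoints_le_of_comp`: never more than upstairs);
* `exists_isPointBlowupComposition_of_isMinimalResolution` — the clause of Lipman's Theorem (4.1) left untyped by
  `Lipman1969_4_1` («any desingularization of `Y` is obtained from the minimal one by quadratic transformations»), for
  `Y = Spec S`: every desingularization factors through a minimal one AS A COMPOSITION OF POINT BLOW-UPS (up to an
  isomorphism of the source).

No crux or summit statement is proved here.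
-/

noncomputable section

-- single-problem summit: the doubled namespace component `ResolutionOfSingularities` is forced
set_option linter.dupNamespace false

open CategoryTheory AlgebraicGeometry TopologicalSpace Topology IsLocalRing
open Literature.AlgebraicGeometry.Resolution
open Scheme.IdealSheafData
open Summit.ResolutionOfSingularities.ResolutionOfSingularities.Theorems.NoZeno.ExcCount.FirstKind

namespace Summit.ResolutionOfSingularities.ResolutionOfSingularities.Theorems.NoZeno.FirstKind

variable {S : Type} [CommRing S] [IsNoetherianRing S] [IsLocalRing S] [IsDomain S] [IsIntegrallyClosed S]

/-- On an integral scheme, a point with two-dimensional local ring is not the only point (the generic point has the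
function field, of dimension `0`, for local ring). [folklore] -/
theorem singleton_ne_univ_of_ringKrullDim_stalk_eq_two {Y : Scheme.{0}} [IsIntegral Y] {y : Y}
    (hy2 : ringKrullDim (Y.presheaf.stalk y) = 2) : ({y} : Set Y) ≠ Set.univ := by
  intro huniv
  have hgen : y = genericPoint Y := by
    have : genericPoint Y ∈ ({y} : Set Y) := huniv ▸ Set.mem_univ _
    exact this.symm
  subst hgen
  have h0 : ringKrullDim Y.functionField = 0 :=
    ringKrullDim_eq_zero_of_isField (Field.toIsField Y.functionField)
  have h20 : (2 : WithBot ℕ∞) = 0 := hy2.symm.trans h0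
  exact absurd h20 (by decide)

/-- **Zariski's factorisation theorem for desingularizations of a normal surface singularity** (Stacks 0C5R: "Let
`f : X → Y` be a proper birational morphism between integral Noetherian schemes regular of dimension 2. Then `f` is a
sequence of blowups in closed points.").  For `S` a two-dimensional Noetherian local normal domain, `π : X → Spec S`
and `ρ : Y → Spec S` desingularizations and `h : X → Y` with `h ≫ ρ = π`: there are an isomorphism `e : X ⥲ X'` and a
composition `π' : X' → Y` of blowings up at closed points lying over the closed point of `S` with `h = e ≫ π'`.
Induction on `#excCurvePoints π − #excCurvePoints ρ` with the one-step descent `FirstKind.step`.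
[cite: StacksProject, Tag 0C5R]; [cite: Lipman1969, Theorem (4.1) (p. 204)] -/
theorem exists_isPointBlowupComposition_of_fac (h2 : ringKrullDim S = 2) {X : Scheme.{0}}
    {π : X ⟶ Spec (.of S)} (hπ : IsResolution π) :
    ∀ (Y : Scheme.{0}) (ρ : Y ⟶ Spec (.of S)) (h : X ⟶ Y), IsResolution ρ → h ≫ ρ = π →
      ∃ (X' : Scheme.{0}) (e : X ⟶ X') (_ : IsIso e) (π' : X' ⟶ Y),
        IsPointBlowupComposition (ρ.base ⁻¹' {closedPoint S}) π' ∧ e ≫ π' = h := by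
  suffices H : ∀ (k : ℕ) (Y : Scheme.{0}) (ρ : Y ⟶ Spec (.of S)) (h : X ⟶ Y), IsResolution ρ → h ≫ ρ = π →
      (excCurvePoints π).ncard ≤ (excCurvePoints ρ).ncard + k →
      ∃ (X' : Scheme.{0}) (e : X ⟶ X') (_ : IsIso e) (π' : X' ⟶ Y),
        IsPointBlowupComposition (ρ.base ⁻¹' {closedPoint S}) π' ∧ e ≫ π' = h from
    fun Y ρ h hρ hh => H _ Y ρ h hρ hh (Nat.le_add_left _ _)
  -- the descent step, with the bookkeeping shared by both cases of the induction
  have hdesc : ∀ (Y : Scheme.{0}) (ρ : Y ⟶ Spec (.of S)) (h : X ⟶ Y), IsResolution ρ → h ≫ ρ = π → ¬ IsIso h →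
      ∃ (Y₁ : Scheme.{0}) (b : Y₁ ⟶ Y) (h₁ : X ⟶ Y₁), IsResolution (b ≫ ρ) ∧ h₁ ≫ b = h ∧
        IsPointBlowupComposition (ρ.base ⁻¹' {closedPoint S}) b ∧
        (excCurvePoints ρ).ncard + 1 ≤ (excCurvePoints (b ≫ ρ)).ncard ∧
        (excCurvePoints (b ≫ ρ)).ncard ≤ (excCurvePoints π).ncard := by
    intro Y ρ h hρ hh hne
    subst hh
    obtain ⟨y, hy, hy2, Y₁, b, h₁, hb, hh₁, hbρ⟩ := step h2 hπ hρ hne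
    haveI : IsIntegral Y := hρ.isIntegral_source
    haveI : IsProper ρ := hρ.isProper
    have hyT : y ∈ ρ.base ⁻¹' {closedPoint S} := base_eq_closedPoint_of_isClosed ρ hy
    have hsingle : IsPointBlowupComposition (ρ.base ⁻¹' {closedPoint S}) b :=
      IsPointBlowupComposition.single b y hy (singleton_ne_univ_of_ringKrullDim_stalk_eq_two hy2) hyT hb
    have hc2 := ncard_excCurvePoints_blowup_point h2 ρ hρ hy hy2 b hb hbρ
    have hπ₁ : h₁ ≫ b ≫ ρ = h ≫ ρ := by rw [← Category.assoc, hh₁]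
    have hres₁ : IsResolution (h₁ ≫ b ≫ ρ) := by rw [hπ₁]; exact hπ
    have hc1 := ncard_excCurvePoints_le_of_comp h2 (b ≫ ρ) h₁ hbρ hres₁
    rw [hπ₁] at hc1
    exact ⟨Y₁, b, h₁, hbρ, hh₁, hsingle, hc2, hc1⟩
  -- the isomorphism case
  have hiso : ∀ (Y : Scheme.{0}) (ρ : Y ⟶ Spec (.of S)) (h : X ⟶ Y), IsIso h →
      ∃ (X' : Scheme.{0}) (e : X ⟶ X') (_ : IsIso e) (π' : X' ⟶ Y),
        IsPointBlowupComposition (ρ.base ⁻¹' {closedPoint S}) π' ∧ e ≫ π' = h :=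
    fun Y ρ h hh => ⟨Y, h, hh, 𝟙 Y, IsPointBlowupComposition.nil, Category.comp_id h⟩
  intro k
  induction k with
  | zero =>
    intro Y ρ h hρ hh hle
    by_cases hh' : IsIso h
    · exact hiso Y ρ h hh'
    · obtain ⟨Y₁, b, h₁, -, -, -, hc2, hc1⟩ := hdesc Y ρ h hρ hh hh'
      omega
  | succ k ih =>
    intro Y ρ h hρ hh hle
    by_cases hh' : IsIso h
    · exact hiso Y ρ h hh'
    · obtain ⟨Y₁, b, h₁, hbρ, hh₁, hsingle, hc2, hc1⟩ := hdesc Y ρ h hρ hh hh'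
      have hπ₁ : h₁ ≫ b ≫ ρ = π := by rw [← Category.assoc, hh₁, hh]
      obtain ⟨X', e, he, π₁', hcomp, heπ⟩ := ih Y₁ (b ≫ ρ) h₁ hbρ hπ₁ (by omega)
      refine ⟨X', e, he, π₁' ≫ b, ?_, by rw [← Category.assoc, heπ, hh₁]⟩
      refine hsingle.comp (T₁ := (b ≫ ρ).base ⁻¹' {closedPoint S}) ?_ hcomp
      rintro _ ⟨z, hz, rfl⟩
      simpa [Scheme.Hom.comp_apply] using hz

/-- **The untyped clause of Lipman (4.1) over a normal surface singularity: every desingularization is a product of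
quadratic transformations of the minimal one.**  For `S` a two-dimensional Noetherian local normal domain,
`f : X₀ → Spec S` a minimal desingularization (`IsMinimalResolution`) and `g : Z → Spec S` any desingularization,
`g = e ≫ π' ≫ f` with `e` an isomorphism and `π'` a composition of blowings up at closed points over the closed point.
[cite: Lipman1969, Theorem (4.1) (p. 204): "any desingularization of Y is a product of quadratic transformations"];
[cite: StacksProject, Tag 0C5R] -/
theorem exists_isPointBlowupComposition_of_isMinimalResolution (h2 : ringKrullDim S = 2) {X₀ Z : Scheme.{0}}
    {f : X₀ ⟶ Spec (.of S)} (hf : IsMinimalResolution f) {g : Z ⟶ Spec (.of S)} (hg : IsResolution g) :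
    ∃ (Z' : Scheme.{0}) (e : Z ⟶ Z') (_ : IsIso e) (π' : Z' ⟶ X₀),
      IsPointBlowupComposition (f.base ⁻¹' {closedPoint S}) π' ∧ e ≫ π' ≫ f = g := by
  obtain ⟨k, hk⟩ := hf.2 Z g hg
  obtain ⟨Z', e, he, π', hcomp, heπ⟩ := exists_isPointBlowupComposition_of_fac h2 hg X₀ f k hf.1 hk
  exact ⟨Z', e, he, π', hcomp, by rw [← Category.assoc, heπ, hk]⟩

end Summit.ResolutionOfSingularities.ResolutionOfSingularities.Theorems.NoZeno.FirstKind

end
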